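import Literature.Barriers.ResolutionOfSingularities.ResidualOrderUnboundedExample1Cycle
import Literature.Barriers.ResolutionOfSingularities.ResidualOrderUnboundedExample2Cycle
import HarnessLib

/-!
# Hauser–Perlega 2019 holds: the residual order tends to infinity along point blow-ups

`Literature/Barriers/ResolutionOfSingularities/ResidualOrderUnboundedHolds.lean` — discharge of the
named fact `HauserPerlega.HauserPerlega2019` of the barrier file `ResidualOrderUnbounded.lean`
("There exists a purely inseparable hypersurface singularity `X` and a sequence of permissible
blowups along which the order of `X` remains constant but for which the orders of the residual
ideals `I` tend to infinity" [cite: HauserPerlega2019, §1], rendered for point blow-ups with the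
printed scope of the two example families: `p = 2, e = 3, n = 5` and `p` odd, `e = 3, n = 4`).

Both conjuncts are PROVED by running the printed cycles of [cite: HauserPerlega2019, §4] for ever:
`hasDivergentPointBlowupSequence_two` (`ResidualOrderUnboundedExample1Cycle.lean`: First example,
`F⁰ = x⁴y⁴w⁶(w² + x³u¹⁰)`, cycles of `5d/2 + 15` point blow-ups raising the residual order from
`d` to `d + 2`, `y ↔ u` exchanged after each cycle) and `hasDivergentPointBlowupSequence_odd`
(`ResidualOrderUnboundedExample2Cycle.lean`: Second example, `d = c·p(p−1)/2` raised by `p(p−1)/2`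
per cycle), on top of the support/coefficient calculus of `ResidualOrderUnboundedBlowup.lean` and
`ResidualOrderUnboundedBounds.lean`. The examples work over EVERY field of the respective
characteristic; the named fact only asks for algebraically closed ones. Consequently
`not_mohStabilityClaim HauserPerlega2019_holds : ¬ MohStabilityClaim`, the statement already
proved unconditionally as `mohStabilityClaim_false` (kernel computation of eleven blow-ups) in
`ResidualOrderUnboundedProofs.lean`; it is not restated here.
-/

namespace Literature.Barriers.ResolutionOfSingularities

namespace HauserPerlega

/-- **Hauser–Perlega 2019** (J. Algebraic Geom. 28; arXiv:1802.05010), main theorem with its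
printed scope, DISCHARGED: for every algebraically closed field of characteristic `2` there is a
point blow-up sequence with `pᵉ = 8`, `n = 5` whose residual order tends to infinity while
`ord f = 8` throughout, and for every odd prime `p` and every algebraically closed field of
characteristic `p` one with `pᵉ = p³`, `n = 4`. [cite: HauserPerlega2019, §1 (main statement), §4 (Examples 1 and 2)] -/
theorem HauserPerlega2019_holds : HauserPerlega2019 :=
  ⟨fun K _ _ _ => hasDivergentPointBlowupSequence_two K,
    fun p K _ _ _ hp hp2 => hasDivergentPointBlowupSequence_odd p K hp hp2⟩

end HauserPerlega

end Literature.Barriers.ResolutionOfSingularities
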